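import Summits.ResolutionOfSingularities.ResolutionOfSingularities.Theorems.ShadowGameWin.Negative.Mirror

/-!
# `ShadowGameWin` (crux stmt-ResolutionOfSingularities-16159), negative side — part 5a:
# the move generator on monomials in `k + 2` variables

Closed forms, for the mirrored move generator of `ShadowGame.ShadowGameWin` (`Mirror.lean`) in
`n = k + 2` variables, of the blow-up `bl`, the division `dv` and the translation `tr` on a single
monomial `monoN e v = v · u^e` (`bl_monoN`, `dv_monoN`, `tr_monoN` — the last for the chart `u = u_0`
with `v = u_1` translated by `τ_v = 1` and every other translated coordinate by `0`), the identity
`tr = id` when every translated coordinate is translated by `0` (`tr_eq_self_of_tau_zero`), and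
bookkeeping for exponent vectors `vec2 a b = (a, b, 0, …, 0)` supported on the first two
coordinates.  Used by part 5b (`EveryDim.lean`: B wins `SG_p(n)` for every prime `p` and every
`n ≥ 2`).  General in the field `κ`; reusable for other traps.
Refuter seat refuter-cdisprove-stmt-ResolutionOfSingularities-16159-0, 2026-08-17.
-/

noncomputable section

set_option linter.dupNamespace false

namespace Summit.ResolutionOfSingularities.ResolutionOfSingularities.Theorems.ShadowGameWin.Negative

section EveryDim

variable {κ : Type} [Field κ] {k : ℕ}

/-! ## Monomials in `k + 2` variables; exponent vectors supported on the first two coordinates -/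

/-- The exponent vector `(a, b, 0, …, 0)` in `k + 2` variables. [folklore] -/
def vec2 (a b : ℕ) : Fin (k + 2) → ℕ := fun j => if j = 0 then a else if j = 1 then b else 0

/-- A monomial `v · u^e` in `k + 2` variables as a coefficient function. [folklore] -/
def monoN (e : Fin (k + 2) → ℕ) (v : κ) : (Fin (k + 2) → ℕ) → κ := fun B => if B = e then v else 0

omit [Field κ] in
/-- First entry of `vec2`. [folklore] -/
theorem vec2_zero (a b : ℕ) : (vec2 a b : Fin (k + 2) → ℕ) 0 = a := rfl

omit [Field κ] in
/-- Second entry of `vec2`. [folklore] -/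
theorem vec2_one (a b : ℕ) : (vec2 a b : Fin (k + 2) → ℕ) 1 = b := by
  simp [vec2]

omit [Field κ] in
/-- Dummy entries of `vec2` vanish. [folklore] -/
theorem vec2_of_two_le (a b : ℕ) (j : Fin (k + 2)) (hj : 2 ≤ j.val) :
    (vec2 a b : Fin (k + 2) → ℕ) j = 0 := by
  have h0 : j ≠ 0 := fun h => by simp [h] at hj
  have h1 : j ≠ 1 := fun h => by simp [h] at hj
  simp [vec2, h0, h1]

/-- Blow-up of `V(u_j : j ∈ F)` in the chart `i` on a monomial: `u^e ↦ u^(e + σ·e_i)` with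
`σ = Σ_{j ∈ F ∖ i} e_j`. [folklore] -/
theorem bl_monoN (F : Finset (Fin (k + 2))) (i : Fin (k + 2)) (e : Fin (k + 2) → ℕ) (v : κ) :
    bl F i (monoN e v) =
      monoN (Function.update e i (e i + Finset.sum (F.erase i) (fun j => e j))) v := by
  funext B
  unfold bl monoN
  by_cases hB : B = Function.update e i (e i + Finset.sum (F.erase i) (fun j => e j))
  · rw [if_pos hB]
    have hBj : ∀ j, j ≠ i → B j = e j := fun j hj => by rw [hB, Function.update_of_ne hj]
    have hBi : B i = e i + Finset.sum (F.erase i) (fun j => e j) := by rw [hB]; simp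
    have hsum : Finset.sum (F.erase i) (fun j => B j) = Finset.sum (F.erase i) (fun j => e j) :=
      Finset.sum_congr rfl fun j hj => hBj j (Finset.ne_of_mem_erase hj)
    rw [hsum, if_pos (by omega), if_pos]
    funext j
    by_cases hj : j = i
    · subst hj; simp [hBi]
    · rw [Function.update_of_ne hj, hBj j hj]
  · rw [if_neg hB]
    split_ifs with h1 h2
    · exfalso; apply hB
      funext j
      by_cases hj : j = i
      · subst hj
        have hsum : Finset.sum (F.erase j) (fun l => B l) = Finset.sum (F.erase j) (fun l => e l) :=
          Finset.sum_congr rfl fun l hl => by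
            have := congrFun h2 l
            rwa [Function.update_of_ne (Finset.ne_of_mem_erase hl)] at this
        have hi := congrFun h2 j
        simp only [Function.update_self] at hi
        simp only [Function.update_self]
        omega
      · rw [Function.update_of_ne hj]
        have := congrFun h2 j
        rwa [Function.update_of_ne hj] at this
    · rfl
    · rfl

/-- Division by `u_i ^ s` on a monomial. [folklore] -/
theorem dv_monoN (i : Fin (k + 2)) (s : ℕ) (e : Fin (k + 2) → ℕ) (v : κ) (hs : s ≤ e i) :
    dv i s (monoN e v) = monoN (Function.update e i (e i - s)) v := by
  funext B
  unfold dv monoN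
  by_cases hB : B = Function.update e i (e i - s)
  · rw [if_pos hB, if_pos]
    funext j
    by_cases hj : j = i
    · subst hj; simp [hB]; omega
    · simp [Function.update_of_ne hj, hB]
  · rw [if_neg hB, if_neg]
    intro h
    apply hB
    funext j
    by_cases hj : j = i
    · subst hj
      have := congrFun h j
      simp at this
      simp; omega
    · have := congrFun h j
      rw [Function.update_of_ne hj] at this
      rw [Function.update_of_ne hj, ← this]

/-- A translation by `0` in every translated coordinate is the identity. [folklore] -/
theorem tr_eq_self_of_tau_zero (F : Finset (Fin (k + 2))) (i : Fin (k + 2)) (τ : Fin (k + 2) → κ)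
    (hτ : ∀ j ∈ F.erase i, τ j = 0) (s : ℕ) (c : (Fin (k + 2) → ℕ) → κ) : tr F i τ s c = c := by
  funext B
  unfold tr
  rw [Finset.sum_eq_single (0 : Fin (k + 2) → ℕ)]
  · rw [if_pos (show ∀ j, j ∉ F.erase i → (0 : Fin (k + 2) → ℕ) j = 0 from fun j _ => rfl)]
    simp
  · intro D _ hne
    by_cases hc : ∀ j, j ∉ F.erase i → D j = 0
    · rw [if_pos hc]
      obtain ⟨j, hj⟩ : ∃ j, D j ≠ 0 := by
        by_contra h
        push Not at h
        exact hne (funext h)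
      have hjF : j ∈ F.erase i := by
        by_contra h
        exact hj (hc j h)
      rw [Finset.prod_eq_zero hjF (by rw [hτ j hjF, zero_pow hj, mul_zero]), mul_zero]
    · rw [if_neg hc]
  · intro h
    exfalso
    exact h (by simp [Fintype.mem_piFinset])

/-- Translation `v ↦ v + 1` (all other translated coordinates by `0`) in the chart `u` on a
monomial `u^e` with `e_v ≤ e_u + s`: the binomial expansion in the coordinate `v`. [folklore] -/
theorem tr_monoN (F : Finset (Fin (k + 2))) (h1 : (1 : Fin (k + 2)) ∈ F) (τ : Fin (k + 2) → κ)
    (hτ1 : τ 1 = 1) (hτ : ∀ j ∈ F.erase 0, j ≠ 1 → τ j = 0) (s : ℕ) (e : Fin (k + 2) → ℕ) (v : κ)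
    (he : e 1 ≤ e 0 + s) :
    tr F 0 τ s (monoN e v) = fun B =>
      if (∀ j, j ≠ 1 → B j = e j) ∧ B 1 ≤ e 1 then v * ((Nat.choose (e 1) (B 1) : ℕ) : κ) else 0 := by
  have h1' : (1 : Fin (k + 2)) ∈ F.erase 0 := Finset.mem_erase.mpr ⟨by simp, h1⟩
  funext B
  unfold tr
  by_cases hB : (∀ j, j ≠ 1 → B j = e j) ∧ B 1 ≤ e 1
  · rw [if_pos hB]
    rw [Finset.sum_eq_single (Pi.single 1 (e 1 - B 1) : Fin (k + 2) → ℕ)]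
    · have hcond : ∀ j : Fin (k + 2), j ∉ F.erase 0 → (Pi.single 1 (e 1 - B 1) : Fin (k + 2) → ℕ) j = 0 := by
        intro j hj
        have : j ≠ 1 := fun h => hj (h ▸ h1')
        simp [this]
      rw [if_pos hcond]
      have hBD : B + Pi.single 1 (e 1 - B 1) = e := by
        funext j
        by_cases hj : j = 1
        · subst hj; simp; omega
        · simp [hj, hB.1 j hj]
      unfold monoN
      rw [hBD, if_pos rfl]
      rw [Finset.prod_eq_single_of_mem (1 : Fin (k + 2)) h1']
      · have h11 : B 1 + (e 1 - B 1) = e 1 := by have := hB.2; omega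
        simp [hτ1, h11]
      · intro j hj hj1
        simp [hj1, Nat.choose_self]
    · intro D _ hne
      by_cases hc : ∀ j, j ∉ F.erase 0 → D j = 0
      · rw [if_pos hc]
        unfold monoN
        rw [if_neg, zero_mul]
        intro hBD
        apply hne
        funext j
        have hj' := congrFun hBD j
        simp only [Pi.add_apply] at hj'
        by_cases hj : j = 1
        · subst hj; simp; omega
        · have := hB.1 j hj
          simp [hj]; omega
      · rw [if_neg hc]
    · intro h
      exfalso
      apply h
      rw [Fintype.mem_piFinset]
      intro j
      by_cases hj : j = 1
      · subst hj
        have := hB.1 0 (by simp)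
        simp [Finset.mem_range]; omega
      · simp [hj]
  · rw [if_neg hB]
    refine Finset.sum_eq_zero fun D _ => ?_
    by_cases hc : ∀ j, j ∉ F.erase 0 → D j = 0
    · rw [if_pos hc]
      unfold monoN
      by_cases hBD : B + D = e
      · rw [if_pos hBD]
        -- some translated coordinate `j ≠ 1` moves (`D j ≠ 0`), and its translation is `0`
        have : ∃ j ∈ F.erase 0, j ≠ 1 ∧ D j ≠ 0 := by
          by_contra hno
          push Not at hno
          apply hB
          have hD : ∀ j, j ≠ 1 → D j = 0 := fun j hj => by
            by_cases hjF : j ∈ F.erase 0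
            · exact hno j hjF hj
            · exact hc j hjF
          refine ⟨fun j hj => ?_, ?_⟩
          · have := congrFun hBD j
            simp only [Pi.add_apply, hD j hj, add_zero] at this
            exact this
          · have := congrFun hBD 1
            simp only [Pi.add_apply] at this
            omega
        obtain ⟨j, hjF, hj1, hDj⟩ := this
        rw [Finset.prod_eq_zero hjF (by rw [hτ j hjF hj1, zero_pow hDj, mul_zero]), mul_zero]
      · rw [if_neg hBD, zero_mul]
    · rw [if_neg hc]


omit [Field κ] in
/-- `vec2 a b` with a new first entry. [folklore] -/
theorem update_vec2_zero (a b c : ℕ) :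
    Function.update (vec2 a b : Fin (k + 2) → ℕ) 0 c = vec2 c b := by
  funext j
  by_cases hj : j = 0
  · subst hj; simp [vec2]
  · rw [Function.update_of_ne hj]; simp [vec2, hj]

omit [Field κ] in
/-- `update f a (f a + 0) = f`. [folklore] -/
theorem update_add_zero_self (f : Fin (k + 2) → ℕ) (a : Fin (k + 2)) :
    Function.update f a (f a + 0) = f := by
  simp

omit [Field κ] in
/-- Characterisation of the dummy coordinates `j ≥ 2`. [folklore] -/
theorem two_le_val_iff (j : Fin (k + 2)) : 2 ≤ j.val ↔ j ≠ 0 ∧ j ≠ 1 := by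
  constructor
  · intro h
    exact ⟨fun h0 => by simp [h0] at h, fun h1 => by simp [h1] at h⟩
  · rintro ⟨h0, h1⟩
    have h0' : j.val ≠ 0 := fun h => h0 (Fin.ext h)
    have h1' : j.val ≠ 1 := fun h => h1 (Fin.ext (by simpa using h))
    omega

omit [Field κ] in
/-- `Σ_{j ∈ F} (a, b, 0, …, 0)_j`. [folklore] -/
theorem sum_vec2 (F : Finset (Fin (k + 2))) (a b : ℕ) :
    Finset.sum F (fun j => (vec2 a b : Fin (k + 2) → ℕ) j) =
      (if (0 : Fin (k + 2)) ∈ F then a else 0) + (if (1 : Fin (k + 2)) ∈ F then b else 0) := by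
  have h : ∀ j : Fin (k + 2), (vec2 a b : Fin (k + 2) → ℕ) j =
      (if j = 0 then a else 0) + (if j = 1 then b else 0) := by
    intro j
    unfold vec2
    by_cases h0 : j = 0
    · subst h0; simp
    · by_cases h1 : j = 1
      · subst h1; simp
      · simp [h0, h1]
  simp_rw [h]
  rw [Finset.sum_add_distrib, Finset.sum_ite_eq', Finset.sum_ite_eq']

omit [Field κ] in
/-- `B = (a, b, 0, …, 0)` coordinatewise. [folklore] -/
theorem eq_vec2_iff (B : Fin (k + 2) → ℕ) (a b : ℕ) :
    B = vec2 a b ↔ B 0 = a ∧ B 1 = b ∧ ∀ j : Fin (k + 2), 2 ≤ j.val → B j = 0 := by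
  constructor
  · rintro rfl
    exact ⟨rfl, vec2_one a b, fun j hj => vec2_of_two_le a b j hj⟩
  · rintro ⟨h0, h1, h2⟩
    funext j
    by_cases hj0 : j = 0
    · subst hj0; rw [h0]; rfl
    · by_cases hj1 : j = 1
      · subst hj1; rw [h1, vec2_one]
      · rw [h2 j ((two_le_val_iff j).mpr ⟨hj0, hj1⟩),
          vec2_of_two_le a b j ((two_le_val_iff j).mpr ⟨hj0, hj1⟩)]

omit [Field κ] in
/-- `B` agrees with `(a, b, 0, …, 0)` off the coordinate `v`. [folklore] -/
theorem forall_ne_one_iff (B : Fin (k + 2) → ℕ) (a b : ℕ) :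
    (∀ j : Fin (k + 2), j ≠ 1 → B j = (vec2 a b : Fin (k + 2) → ℕ) j) ↔
      B 0 = a ∧ ∀ j : Fin (k + 2), 2 ≤ j.val → B j = 0 := by
  constructor
  · intro h
    refine ⟨h 0 (by simp), fun j hj => ?_⟩
    rw [h j ((two_le_val_iff j).mp hj).2, vec2_of_two_le a b j hj]
  · rintro ⟨h0, h2⟩ j hj
    by_cases hj0 : j = 0
    · subst hj0; rw [h0]; rfl
    · rw [h2 j ((two_le_val_iff j).mpr ⟨hj0, hj⟩), vec2_of_two_le a b j ((two_le_val_iff j).mpr ⟨hj0, hj⟩)]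

end EveryDim

end Summit.ResolutionOfSingularities.ResolutionOfSingularities.Theorems.ShadowGameWin.Negative

end
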